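import Mathlib.Analysis.InnerProductSpace.Adjoint
import Mathlib.Analysis.Analytic.Constructions
import Mathlib.Analysis.Analytic.Linear
import Literature.Analysis.Calculus.StrictlyCoerciveOperator
import HarnessLib

/-!
# The Re-coercive pencil `A + σK` over `ℝ` or `ℂ`: resolvent with the two-norm constant, the rank-one
# (Evans-function) kernel criterion, analyticity on the coercive half-plane

`Literature/Analysis/OperatorTheory`; proofs-layer file (theorems only; no definitions, no named facts); scalars `𝕜` with
`[RCLike 𝕜]` (§3: any normed field), so the same names serve a real certificate and its complex-`σ` spectral companion.
Setting: energy Hilbert space `E`, pivot Hilbert space `W`, embedding `ι : E →L W`, Gram operator `K` with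
`⟪K u, u⟫ = ‖ι u‖²` (e.g. `K = ι†ι`, `inner_adjoint_comp_self_eq_norm_sq`), and ONE printed coercivity inequality for an
operator `A` (the rank-one–lifted linearisation `A_F = DG + F` of a spectral certificate).
**§1** Lax–Milgram with the constant in operator form over `ℝ`/`ℂ` — the tree's
`Literature.Analysis.Calculus.strictlyCoercive_exists_equiv` [Kress2014, Thm. 13.29] — in the DATA shape the certificate
chains consume (`exists_inverse_of_re_coercive`, `ring_inverse_re_coercive`: two-sided inverse + `‖P⁻¹ v‖ ≤ c⁻¹‖v‖`), the
a-posteriori enclosure `‖P⁻¹ v − ũ‖ ≤ c⁻¹‖v − P ũ‖` (`norm_inverse_sub_le_of_re_residual`) and the TWO-NORM bound: if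
`c_W‖ι u‖² ≤ Re⟪P u, u⟫` then `P u = ι† g ⇒ ‖ι u‖ ≤ c_W⁻¹‖g‖`, i.e. `‖ι P⁻¹ ι†‖_{W→W} ≤ 1/c_W`
(`norm_pivot_le_of_re_coercive`, `norm_pivot_le_of_eq_adjoint`, `norm_pivot_ring_inverse_adjoint_le`).
**§2** The pencil: from `a(‖u‖² − ‖ι u‖²) + b‖ι u‖² ≤ Re⟪A u, u⟫` (`a > 0`, `‖ι u‖ ≤ ‖u‖`), for `0 < b + Re σ` the operator
`A + σK` is `E`-coercive with `min a (b + Re σ)` and `W`-coercive with `b + Re σ` (`re_inner_pencil`, `pencil_re_coercive`,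
`pencil_re_coercive_pivot`), hence a unit with `‖(A + σK)⁻¹‖ ≤ 1/min a (b + Re σ)` and `‖ι (A + σK)⁻¹ ι† g‖ ≤ ‖g‖/(b + Re σ)`
(`isUnit_pencil`, `norm_ring_inverse_pencil_le`, `norm_pivot_ring_inverse_pencil_le`) [Kato1966, V-§3.10–3.11, elementary case].
**§3** Rank one, KERNEL form (Sherman–Morrison, `N = 1`): for `P` with two-sided inverse `R`, `Q u := P u − ℓ(u) f`:
`ℓ(R f) = 1 ⇒ Q (R f) = 0 ≠ R f`; `Q u = 0 ≠ u ⇒ ℓ(R f) = 1`, `u = ℓ(u) • R f`; `ℓ(R f) ≠ 1 ⇒` explicit two-sided inverse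
`v ↦ R v + (ℓ(R v)/(1 − ℓ(R f))) • R f`; so `(∃ u ≠ 0, Q u = 0) ↔ ℓ(R f) = 1` and `IsUnit Q ↔ ℓ(R f) ≠ 1`
(`rankOne_apply_inverse_eq_zero`, `evans_eq_one_of_rankOne_kernel`, `rankOne_inverse`, `rankOne_kernel_iff`,
`rankOne_isUnit_iff`) [Kato1966, III-§4.3 (4.13): Kato's determinant at rank one; W. W. Hager, SIAM Rev. 31 (1989) §2];
the finite-rank capacitance version is the tree's `…OperatorTheory.FiniteRankCapacitance` (its `N = 1` case, here with the
explicit scalar and BOTH directions of the kernel statement, which that file does not carry).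
**§4** Analyticity: `σ ↦ Ring.inverse (A + σK)` is analytic wherever the pencil is a unit (Mathlib `analyticAt_inverse` ∘
affine pencil), hence on `{−b < Re σ}`; so is the EVANS FUNCTION `E(σ) = 1 − θ ℓ((A + σK)⁻¹ f)` (`analyticAt_evans`,
`analyticOnNhd_evans`) — the hypothesis under which the tree's `Literature.Analysis.Complex.ArgumentPrincipleRectangle` /
`…ArgumentPrincipleWinding` count its zeros, which by §3 are exactly the `σ` at which `A + σK − θ ℓ(·) f` has a nontrivial
kernel (`pencil_rankOne_kernel_iff`).
MOTIVATION (provenance only): cell ns-blowup, zone Z3, case Z3-SR-SPEC (`HOME/profile/cert/impl1/sheetR/spec/`, PREREG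
fad67dc3bd2becee; profile-lead RULING (dx)(4), profile-refuter rider R3): `E =` complex odd `H¹_{64+ξ²}`, `W = L²_w`,
`A = A_F`, `a = c₂`, `b = c₁ + γ`, `c_w(σ) = c₁ + γ + Re σ`, `E(σ) = 1 − θ (v₀, (A_F + σJ)⁻¹ J h)_E`: sentences (P1) (bounded
invertibility on the half-plane with `‖𝒜(σ)⁻¹J‖_{w→w} ≤ 1/c_w(σ)`), (P2) (eigenvalue iff `E(σ) = 0`) and the analyticity of
`E` become citable by name at complex `σ`; the order-of-zero = algebraic-multiplicity step (Gohberg–Sigal), semigroup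
generation and growth bound = spectral bound stay paper.  WHAT THIS IS NOT: nothing about Navier–Stokes or Euler.

## References
* [Kress2014] R. Kress, *Linear Integral Equations*, 3rd ed., Springer 2014, §13.6 Thm. 13.29 — tree:
  `Literature/Analysis/Calculus/StrictlyCoerciveOperator.lean`.
* [Kato1966] T. Kato, *Perturbation Theory for Linear Operators*, Springer 1966, III-§4.3 (4.13), IV-§1.4 Thm. 1.16,
  V-§3.10–3.11, VII-§1.1.
-/

noncomputable section

open scoped InnerProductSpace
open RCLike

namespace Literature.Analysis.OperatorTheory

/-! ### §1 Re-coercive operators on a Hilbert space over `ℝ` or `ℂ`: inverse with the constant, enclosure, pivot bound -/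

section Coercive

variable {𝕜 : Type*} [RCLike 𝕜]
variable {E : Type*} [NormedAddCommGroup E] [InnerProductSpace 𝕜 E]
variable {W : Type*} [NormedAddCommGroup W] [InnerProductSpace 𝕜 W]

/-- A-priori bound: `c‖u‖² ≤ Re⟪P u, u⟫` gives `‖u‖ ≤ c⁻¹‖P u‖` (no completeness needed).
[cite: Kress2014, §13.6 Thm. 13.29 (proof, (13.53))] -/
theorem norm_le_inv_mul_norm_of_re_coercive (P : E →L[𝕜] E) {c : ℝ} (hc : 0 < c)
    (hP : ∀ u, c * ‖u‖ ^ 2 ≤ re ⟪P u, u⟫_𝕜) (u : E) : ‖u‖ ≤ c⁻¹ * ‖P u‖ :=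
  (le_inv_mul_iff₀ hc).2 (Literature.Analysis.Calculus.strictlyCoercive_norm_le P hP u)

/-- **Two-norm (pivot) bound.**  If `c_W‖ι u‖² ≤ Re⟪P u, u⟫` for all `u` and `u` solves an equation whose
right-hand side is represented through the pivot, `Re⟪P u, u⟫ ≤ ‖g‖‖ι u‖`, then `‖ι u‖ ≤ c_W⁻¹‖g‖`
(no completeness needed). [cite: Kato1966, V-§3.10 (resolvent bound of an accretive operator), elementary case] -/
theorem norm_pivot_le_of_re_coercive (P : E →L[𝕜] E) (ι : E →L[𝕜] W) {c : ℝ} (hc : 0 < c)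
    (hP : ∀ u, c * ‖ι u‖ ^ 2 ≤ re ⟪P u, u⟫_𝕜) {u : E} {g : W}
    (hu : re ⟪P u, u⟫_𝕜 ≤ ‖g‖ * ‖ι u‖) : ‖ι u‖ ≤ c⁻¹ * ‖g‖ := by
  have h1 : c * ‖ι u‖ ^ 2 ≤ ‖g‖ * ‖ι u‖ := (hP u).trans hu
  rcases eq_or_ne (ι u) 0 with h0 | h0
  · rw [h0, norm_zero]; positivity
  · have hpos : 0 < ‖ι u‖ := norm_pos_iff.2 h0
    rw [le_inv_mul_iff₀ hc]
    nlinarith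

variable [CompleteSpace E]

/-- **Lax–Milgram with the constant, operator form over `ℝ` or `ℂ`, in the data shape of the certificate chains**:
`c‖u‖² ≤ Re⟪P u, u⟫`, `c > 0` ⇒ a two-sided bounded inverse `S` with `‖S v‖ ≤ c⁻¹‖v‖`.  (This is
`Literature.Analysis.Calculus.strictlyCoercive_exists_equiv`, repackaged.) [cite: Kress2014, §13.6 Thm. 13.29] -/
theorem exists_inverse_of_re_coercive (P : E →L[𝕜] E) {c : ℝ} (hc : 0 < c)
    (hP : ∀ u, c * ‖u‖ ^ 2 ≤ re ⟪P u, u⟫_𝕜) :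
    ∃ S : E →L[𝕜] E, (∀ v, P (S v) = v) ∧ (∀ u, S (P u) = u) ∧ ∀ v, ‖S v‖ ≤ c⁻¹ * ‖v‖ := by
  obtain ⟨T, hT, -⟩ := Literature.Analysis.Calculus.strictlyCoercive_exists_equiv P hc hP
  have hPT : ∀ v, P (T.symm v) = v := fun v => by
    have h : (T : E →L[𝕜] E) (T.symm v) = v := by simp
    rwa [hT] at h
  refine ⟨(T.symm : E →L[𝕜] E), hPT, fun u => ?_, fun v => ?_⟩
  · have h : T.symm ((T : E →L[𝕜] E) u) = u := by simp
    rwa [hT] at h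
  · simpa [hPT] using norm_le_inv_mul_norm_of_re_coercive P hc hP (T.symm v)

/-- A Re-coercive operator is a unit and `Ring.inverse P` is its two-sided inverse, with the constant.
[cite: Kress2014, §13.6 Thm. 13.29] -/
theorem ring_inverse_re_coercive (P : E →L[𝕜] E) {c : ℝ} (hc : 0 < c)
    (hP : ∀ u, c * ‖u‖ ^ 2 ≤ re ⟪P u, u⟫_𝕜) :
    IsUnit P ∧ (∀ v, P (Ring.inverse P v) = v) ∧ (∀ u, Ring.inverse P (P u) = u) ∧
      ∀ v, ‖Ring.inverse P v‖ ≤ c⁻¹ * ‖v‖ := by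
  have hU : IsUnit P := Literature.Analysis.Calculus.strictlyCoercive_isUnit P hc hP
  have h1 : ∀ v, P (Ring.inverse P v) = v := fun v => by
    simpa using congrArg (fun T : E →L[𝕜] E => T v) (Ring.mul_inverse_cancel P hU)
  refine ⟨hU, h1, fun u => ?_, fun v => ?_⟩
  · simpa using congrArg (fun T : E →L[𝕜] E => T u) (Ring.inverse_mul_cancel P hU)
  · simpa [h1 v] using norm_le_inv_mul_norm_of_re_coercive P hc hP (Ring.inverse P v)

omit [CompleteSpace E] in
/-- **A-posteriori enclosure of an approximate solve**: with `S` a right inverse of `P`,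
`‖S v − ũ‖ ≤ c⁻¹‖v − P ũ‖` (no completeness needed). [cite: Kress2014, §13.6 Thm. 13.29 (the bound `‖A⁻¹‖ ≤ 1/c`)] -/
theorem norm_inverse_sub_le_of_re_residual (P : E →L[𝕜] E) {c : ℝ} (hc : 0 < c)
    (hP : ∀ u, c * ‖u‖ ^ 2 ≤ re ⟪P u, u⟫_𝕜) (S : E →L[𝕜] E) (hPS : ∀ v, P (S v) = v)
    (v utilde : E) : ‖S v - utilde‖ ≤ c⁻¹ * ‖v - P utilde‖ := by
  simpa [map_sub, hPS] using norm_le_inv_mul_norm_of_re_coercive P hc hP (S v - utilde)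

variable [CompleteSpace W]

/-- The pivot representation of a right-hand side `ι† g`: `Re⟪ι† g, u⟫ ≤ ‖g‖‖ι u‖` (adjoint identity and
Cauchy–Schwarz). [cite: Kato1966, V-§3.10 (accretive operators; the elementary estimate)] -/
theorem re_inner_adjoint_le (ι : E →L[𝕜] W) (g : W) (u : E) :
    re ⟪(ContinuousLinearMap.adjoint ι) g, u⟫_𝕜 ≤ ‖g‖ * ‖ι u‖ := by
  rw [ContinuousLinearMap.adjoint_inner_left]
  exact re_inner_le_norm g (ι u)

/-- **The `W → W` bound of `ι P⁻¹ ι†`**: if `c_W‖ι u‖² ≤ Re⟪P u, u⟫` (`c_W > 0`) and `P u = ι† g`, then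
`‖ι u‖ ≤ c_W⁻¹‖g‖`. [cite: Kato1966, V-§3.10, elementary case] -/
theorem norm_pivot_le_of_eq_adjoint (P : E →L[𝕜] E) (ι : E →L[𝕜] W) {c : ℝ} (hc : 0 < c)
    (hP : ∀ u, c * ‖ι u‖ ^ 2 ≤ re ⟪P u, u⟫_𝕜) {u : E} {g : W}
    (hu : P u = (ContinuousLinearMap.adjoint ι) g) : ‖ι u‖ ≤ c⁻¹ * ‖g‖ :=
  norm_pivot_le_of_re_coercive P ι hc hP (by rw [hu]; exact re_inner_adjoint_le ι g u)

/-- **The `W → W` bound for `Ring.inverse`**: if `P` is `E`-coercive (so that `Ring.inverse P` is its inverse)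
and `c_W‖ι u‖² ≤ Re⟪P u, u⟫`, then `‖ι (P⁻¹ (ι† g))‖ ≤ c_W⁻¹‖g‖` for every `g ∈ W`.
[cite: Kato1966, V-§3.10, elementary case] -/
theorem norm_pivot_ring_inverse_adjoint_le (P : E →L[𝕜] E) (ι : E →L[𝕜] W) {cE cW : ℝ}
    (hcE : 0 < cE) (hE : ∀ u, cE * ‖u‖ ^ 2 ≤ re ⟪P u, u⟫_𝕜)
    (hcW : 0 < cW) (hW : ∀ u, cW * ‖ι u‖ ^ 2 ≤ re ⟪P u, u⟫_𝕜) (g : W) :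
    ‖ι (Ring.inverse P ((ContinuousLinearMap.adjoint ι) g))‖ ≤ cW⁻¹ * ‖g‖ :=
  norm_pivot_le_of_eq_adjoint P ι hcW hW ((ring_inverse_re_coercive P hcE hE).2.1 _)

end Coercive

/-! ### §2 The pencil `A + σ K` (`K = ι†ι`) on the coercive half-plane -/

section Pencil

variable {𝕜 : Type*} [RCLike 𝕜]
variable {E : Type*} [NormedAddCommGroup E] [InnerProductSpace 𝕜 E]
variable {W : Type*} [NormedAddCommGroup W] [InnerProductSpace 𝕜 W]

/-- The Gram operator of the pivot embedding: `⟪ι†ι u, u⟫ = ‖ι u‖²`. [cite: Kato1966, V-§3.10 (the elementary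
Hilbert-space identities)] -/
theorem inner_adjoint_comp_self_eq_norm_sq [CompleteSpace E] [CompleteSpace W] (ι : E →L[𝕜] W) (u : E) :
    ⟪((ContinuousLinearMap.adjoint ι).comp ι) u, u⟫_𝕜 = ((‖ι u‖ ^ 2 : ℝ) : 𝕜) := by
  rw [ContinuousLinearMap.comp_apply, ContinuousLinearMap.adjoint_inner_left, inner_self_eq_norm_sq_to_K]
  norm_cast

/-- **The pencil identity**: if `⟪K u, u⟫ = ‖ι u‖²` then `Re⟪(A + σK) u, u⟫ = Re⟪A u, u⟫ + Re σ · ‖ι u‖²`.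
[cite: Kato1966, V-§3.11 (the numerical range of a sum), elementary case] -/
theorem re_inner_pencil (A K : E →L[𝕜] E) (ι : E →L[𝕜] W)
    (hK : ∀ u, ⟪K u, u⟫_𝕜 = ((‖ι u‖ ^ 2 : ℝ) : 𝕜)) (σ : 𝕜) (u : E) :
    re ⟪(A + σ • K) u, u⟫_𝕜 = re ⟪A u, u⟫_𝕜 + re σ * ‖ι u‖ ^ 2 := by
  simp only [add_apply, smul_apply, inner_add_left, inner_smul_left, hK, map_add]
  congr 1
  rw [RCLike.mul_re, RCLike.conj_re, RCLike.conj_im, RCLike.ofReal_re, RCLike.ofReal_im]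
  ring

/-- **`E`-coercivity of the pencil.**  From `a(‖u‖² − ‖ι u‖²) + b‖ι u‖² ≤ Re⟪A u, u⟫` and `‖ι u‖ ≤ ‖u‖`:
`min a (b + Re σ) · ‖u‖² ≤ Re⟪(A + σK) u, u⟫`. [cite: Kato1966, V-§3.11 (the numerical range of a sum), elementary case] -/
theorem pencil_re_coercive (A K : E →L[𝕜] E) (ι : E →L[𝕜] W)
    (hK : ∀ u, ⟪K u, u⟫_𝕜 = ((‖ι u‖ ^ 2 : ℝ) : 𝕜)) {a b : ℝ}
    (hA : ∀ u, a * (‖u‖ ^ 2 - ‖ι u‖ ^ 2) + b * ‖ι u‖ ^ 2 ≤ re ⟪A u, u⟫_𝕜)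
    (hι : ∀ u, ‖ι u‖ ≤ ‖u‖) (σ : 𝕜) (u : E) :
    min a (b + re σ) * ‖u‖ ^ 2 ≤ re ⟪(A + σ • K) u, u⟫_𝕜 := by
  rw [re_inner_pencil A K ι hK σ u]
  have h1 := hA u
  have h2 : ‖ι u‖ ^ 2 ≤ ‖u‖ ^ 2 := pow_le_pow_left₀ (norm_nonneg _) (hι u) 2
  -- `min·‖u‖² = min·(‖u‖² − ‖ιu‖²) + min·‖ιu‖² ≤ a(‖u‖² − ‖ιu‖²) + (b + Re σ)‖ιu‖²`
  have h4 : min a (b + re σ) * (‖u‖ ^ 2 - ‖ι u‖ ^ 2) ≤ a * (‖u‖ ^ 2 - ‖ι u‖ ^ 2) :=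
    mul_le_mul_of_nonneg_right (min_le_left _ _) (by linarith)
  have h5 : min a (b + re σ) * ‖ι u‖ ^ 2 ≤ (b + re σ) * ‖ι u‖ ^ 2 :=
    mul_le_mul_of_nonneg_right (min_le_right _ _) (by positivity)
  nlinarith

/-- **`W`-coercivity of the pencil.**  From the same inequality with `0 ≤ a` and `‖ι u‖ ≤ ‖u‖`:
`(b + Re σ)‖ι u‖² ≤ Re⟪(A + σK) u, u⟫`. [cite: Kato1966, V-§3.11, elementary case] -/
theorem pencil_re_coercive_pivot (A K : E →L[𝕜] E) (ι : E →L[𝕜] W)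
    (hK : ∀ u, ⟪K u, u⟫_𝕜 = ((‖ι u‖ ^ 2 : ℝ) : 𝕜)) {a b : ℝ} (ha : 0 ≤ a)
    (hA : ∀ u, a * (‖u‖ ^ 2 - ‖ι u‖ ^ 2) + b * ‖ι u‖ ^ 2 ≤ re ⟪A u, u⟫_𝕜)
    (hι : ∀ u, ‖ι u‖ ≤ ‖u‖) (σ : 𝕜) (u : E) :
    (b + re σ) * ‖ι u‖ ^ 2 ≤ re ⟪(A + σ • K) u, u⟫_𝕜 := by
  rw [re_inner_pencil A K ι hK σ u]
  have h1 := hA u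
  have h2 : ‖ι u‖ ^ 2 ≤ ‖u‖ ^ 2 := pow_le_pow_left₀ (norm_nonneg _) (hι u) 2
  have h4 : 0 ≤ a * (‖u‖ ^ 2 - ‖ι u‖ ^ 2) := mul_nonneg ha (by linarith)
  nlinarith

variable [CompleteSpace E]

/-- **The pencil is a unit on the coercive half-plane**, and `Ring.inverse (A + σK)` is its two-sided inverse
with `‖(A + σK)⁻¹ v‖ ≤ (min a (b + Re σ))⁻¹‖v‖`. [cite: Kress2014, §13.6 Thm. 13.29; Kato1966, V-§3.11] -/
theorem isUnit_pencil (A K : E →L[𝕜] E) (ι : E →L[𝕜] W)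
    (hK : ∀ u, ⟪K u, u⟫_𝕜 = ((‖ι u‖ ^ 2 : ℝ) : 𝕜)) {a b : ℝ} (ha : 0 < a)
    (hA : ∀ u, a * (‖u‖ ^ 2 - ‖ι u‖ ^ 2) + b * ‖ι u‖ ^ 2 ≤ re ⟪A u, u⟫_𝕜)
    (hι : ∀ u, ‖ι u‖ ≤ ‖u‖) {σ : 𝕜} (hσ : 0 < b + re σ) :
    IsUnit (A + σ • K) ∧ (∀ v, (A + σ • K) (Ring.inverse (A + σ • K) v) = v) ∧
      (∀ u, Ring.inverse (A + σ • K) ((A + σ • K) u) = u) ∧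
      ∀ v, ‖Ring.inverse (A + σ • K) v‖ ≤ (min a (b + re σ))⁻¹ * ‖v‖ :=
  ring_inverse_re_coercive (A + σ • K) (lt_min ha hσ) (pencil_re_coercive A K ι hK hA hι σ)

/-- The resolvent bound `‖(A + σK)⁻¹ v‖ ≤ ‖v‖ / min a (b + Re σ)` on `0 < b + Re σ`. [cite: Kato1966, V-§3.11] -/
theorem norm_ring_inverse_pencil_le (A K : E →L[𝕜] E) (ι : E →L[𝕜] W)
    (hK : ∀ u, ⟪K u, u⟫_𝕜 = ((‖ι u‖ ^ 2 : ℝ) : 𝕜)) {a b : ℝ} (ha : 0 < a)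
    (hA : ∀ u, a * (‖u‖ ^ 2 - ‖ι u‖ ^ 2) + b * ‖ι u‖ ^ 2 ≤ re ⟪A u, u⟫_𝕜)
    (hι : ∀ u, ‖ι u‖ ≤ ‖u‖) {σ : 𝕜} (hσ : 0 < b + re σ) (v : E) :
    ‖Ring.inverse (A + σ • K) v‖ ≤ (min a (b + re σ))⁻¹ * ‖v‖ :=
  (isUnit_pencil A K ι hK ha hA hι hσ).2.2.2 v

variable [CompleteSpace W]

/-- **The two-norm resolvent bound** `‖ι (A + σK)⁻¹ ι† g‖_W ≤ ‖g‖_W / (b + Re σ)` on the half-plane — the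
sentence «`‖𝒜(σ)⁻¹J‖_{w→w} ≤ 1/c_w(σ)`» of a spectral certificate. [cite: Kato1966, V-§3.10–3.11, elementary case] -/
theorem norm_pivot_ring_inverse_pencil_le (A K : E →L[𝕜] E) (ι : E →L[𝕜] W)
    (hK : ∀ u, ⟪K u, u⟫_𝕜 = ((‖ι u‖ ^ 2 : ℝ) : 𝕜)) {a b : ℝ} (ha : 0 < a)
    (hA : ∀ u, a * (‖u‖ ^ 2 - ‖ι u‖ ^ 2) + b * ‖ι u‖ ^ 2 ≤ re ⟪A u, u⟫_𝕜)
    (hι : ∀ u, ‖ι u‖ ≤ ‖u‖) {σ : 𝕜} (hσ : 0 < b + re σ) (g : W) :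
    ‖ι (Ring.inverse (A + σ • K) ((ContinuousLinearMap.adjoint ι) g))‖ ≤ (b + re σ)⁻¹ * ‖g‖ :=
  norm_pivot_ring_inverse_adjoint_le (A + σ • K) ι (lt_min ha hσ) (pencil_re_coercive A K ι hK hA hι σ)
    hσ (pencil_re_coercive_pivot A K ι hK ha.le hA hι σ) g

end Pencil

/-! ### §3 Rank-one modification of an invertible operator: the Evans-function kernel criterion -/

section RankOne

variable {𝕜 : Type*} [NontriviallyNormedField 𝕜]
variable {E : Type*} [NormedAddCommGroup E] [NormedSpace 𝕜 E]

/-- If `ℓ(R f) = 1` then `R f` is a nontrivial kernel vector of `Q u = P u − ℓ(u) f` (here `R` is a two-sided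
inverse of `P`). [cite: Kato1966, III-§4.3, (4.13) (degenerate perturbation of rank one; the singular case)] -/
theorem rankOne_apply_inverse_eq_zero (P R : E →L[𝕜] E) (hPR : ∀ v, P (R v) = v)
    (f : E) (ℓ : E →L[𝕜] 𝕜) (h : ℓ (R f) = 1) :
    (P - ℓ.smulRight f) (R f) = 0 ∧ R f ≠ 0 := by
  refine ⟨?_, fun h0 => ?_⟩
  · simp [ContinuousLinearMap.smulRight_apply, hPR, h]
  · rw [h0, map_zero] at h; exact zero_ne_one h

/-- Conversely, a nontrivial kernel vector `u` of `Q u = P u − ℓ(u) f` forces `ℓ(R f) = 1`, and `u = ℓ(u) • R f`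
with `ℓ(u) ≠ 0`. [cite: Kato1966, III-§4.3, (4.13) (degenerate perturbation of rank one; the singular case)] -/
theorem evans_eq_one_of_rankOne_kernel (P R : E →L[𝕜] E) (hRP : ∀ u, R (P u) = u)
    (f : E) (ℓ : E →L[𝕜] 𝕜) {u : E} (hQ : (P - ℓ.smulRight f) u = 0) (hu : u ≠ 0) :
    ℓ (R f) = 1 ∧ u = ℓ u • R f ∧ ℓ u ≠ 0 := by
  have h1 : P u = ℓ u • f := by
    have := hQ
    rw [sub_apply, ContinuousLinearMap.smulRight_apply, sub_eq_zero] at this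
    exact this
  have h2 : u = ℓ u • R f := by
    have := congrArg R h1
    rwa [hRP, map_smul] at this
  have h3 : ℓ u ≠ 0 := by
    intro h0; apply hu; rw [h2, h0, zero_smul]
  refine ⟨?_, h2, h3⟩
  have h4 : ℓ u = ℓ u * ℓ (R f) := by
    conv_lhs => rw [h2]
    rw [map_smul, smul_eq_mul]
  have h5 : ℓ u * (ℓ (R f) - 1) = 0 := by rw [mul_sub, mul_one, ← h4, sub_self]
  rcases mul_eq_zero.1 h5 with h6 | h6
  · exact absurd h6 h3
  · exact sub_eq_zero.1 h6

/-- **Sherman–Morrison, `N = 1`**: if `ℓ(R f) ≠ 1` the operator `Q u = P u − ℓ(u) f` has the explicit two-sided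
inverse `T v = R v + (ℓ(R v)/(1 − ℓ(R f))) • R f`. [cite: Kato1966, III-§4.3, (4.13) (degenerate perturbation of rank one: the Sherman–Morrison formula)] -/
theorem rankOne_inverse (P R : E →L[𝕜] E) (hPR : ∀ v, P (R v) = v) (hRP : ∀ u, R (P u) = u)
    (f : E) (ℓ : E →L[𝕜] 𝕜) (h : ℓ (R f) ≠ 1) :
    let T : E →L[𝕜] E := R + ((1 - ℓ (R f))⁻¹ • (ℓ.comp R)).smulRight (R f)
    (∀ v, (P - ℓ.smulRight f) (T v) = v) ∧ ∀ u, T ((P - ℓ.smulRight f) u) = u := by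
  intro T
  have hd : (1 - ℓ (R f)) ≠ 0 := sub_ne_zero.2 (Ne.symm h)
  have hT : ∀ v, T v = R v + ((1 - ℓ (R f))⁻¹ * ℓ (R v)) • R f := fun v => by
    simp [T, ContinuousLinearMap.smulRight_apply, smul_eq_mul]
  have hQ : ∀ u, (P - ℓ.smulRight f) u = P u - ℓ u • f := fun u => by
    simp [ContinuousLinearMap.smulRight_apply]
  constructor
  · intro v
    rw [hT v, hQ]
    simp only [map_add, map_smul, hPR, smul_eq_mul]
    match_scalars <;> field_simp
    ring
  · intro u
    rw [hT, hQ]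
    simp only [map_sub, map_smul, hRP, smul_eq_mul]
    match_scalars <;> field_simp
    ring

/-- `ℓ(R f) ≠ 1` ⇒ `Q = P − ℓ(·) f` is a unit. [cite: Kato1966, III-§4.3, (4.13) (degenerate perturbation of rank one: the Sherman–Morrison formula)] -/
theorem rankOne_isUnit (P R : E →L[𝕜] E) (hPR : ∀ v, P (R v) = v) (hRP : ∀ u, R (P u) = u)
    (f : E) (ℓ : E →L[𝕜] 𝕜) (h : ℓ (R f) ≠ 1) : IsUnit (P - ℓ.smulRight f) := by
  obtain ⟨h1, h2⟩ := rankOne_inverse P R hPR hRP f ℓ h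
  set T : E →L[𝕜] E := R + ((1 - ℓ (R f))⁻¹ • (ℓ.comp R)).smulRight (R f)
  refine ⟨⟨P - ℓ.smulRight f, T, ?_, ?_⟩, rfl⟩
  · ext v; exact h1 v
  · ext u; exact h2 u

/-- **The kernel criterion**: `Q = P − ℓ(·) f` has a nontrivial kernel iff `ℓ(P⁻¹ f) = 1`.
[cite: Kato1966, III-§4.3, (4.13) (degenerate perturbation of rank one; the singular case)] -/
theorem rankOne_kernel_iff (P R : E →L[𝕜] E) (hPR : ∀ v, P (R v) = v) (hRP : ∀ u, R (P u) = u)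
    (f : E) (ℓ : E →L[𝕜] 𝕜) :
    (∃ u, u ≠ 0 ∧ (P - ℓ.smulRight f) u = 0) ↔ ℓ (R f) = 1 := by
  constructor
  · rintro ⟨u, hu, hQ⟩
    exact (evans_eq_one_of_rankOne_kernel P R hRP f ℓ hQ hu).1
  · intro h
    obtain ⟨h1, h2⟩ := rankOne_apply_inverse_eq_zero P R hPR f ℓ h
    exact ⟨R f, h2, h1⟩

/-- **The invertibility criterion**: `Q = P − ℓ(·) f` is a unit iff `ℓ(P⁻¹ f) ≠ 1`.
[cite: Kato1966, III-§4.3, (4.13) (degenerate perturbation of rank one: the Sherman–Morrison formula)] -/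
theorem rankOne_isUnit_iff (P R : E →L[𝕜] E) (hPR : ∀ v, P (R v) = v) (hRP : ∀ u, R (P u) = u)
    (f : E) (ℓ : E →L[𝕜] 𝕜) : IsUnit (P - ℓ.smulRight f) ↔ ℓ (R f) ≠ 1 := by
  refine ⟨fun hU h => ?_, rankOne_isUnit P R hPR hRP f ℓ⟩
  obtain ⟨h1, h2⟩ := rankOne_apply_inverse_eq_zero P R hPR f ℓ h
  obtain ⟨U, hU'⟩ := hU
  apply h2
  have h3 : (↑U⁻¹ * ↑U : E →L[𝕜] E) (R f) = R f := by rw [U.inv_mul]; rfl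
  rw [mul_apply_eq_comp, hU', h1, map_zero] at h3; exact h3.symm

end RankOne

/-! ### §4 Analyticity of the resolvent of the pencil and of the Evans function -/

section Analytic

variable {𝕜 : Type*} [RCLike 𝕜]
variable {E : Type*} [NormedAddCommGroup E] [InnerProductSpace 𝕜 E] [CompleteSpace E]
variable {W : Type*} [NormedAddCommGroup W] [InnerProductSpace 𝕜 W]

/-- `σ ↦ (A + σK)⁻¹` (as `Ring.inverse`) is analytic at every `σ₀` where the pencil is a unit.
[cite: Kato1966, VII-§1.1 (analyticity of the resolvent of a holomorphic family), elementary case] -/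
theorem analyticAt_ring_inverse_pencil (A K : E →L[𝕜] E) {σ₀ : 𝕜} (hU : IsUnit (A + σ₀ • K)) :
    AnalyticAt 𝕜 (fun σ : 𝕜 => Ring.inverse (A + σ • K)) σ₀ := by
  have h1 : AnalyticAt 𝕜 (fun σ : 𝕜 => A + σ • K) σ₀ := analyticAt_const.add (analyticAt_id.smul analyticAt_const)
  have h2 : AnalyticAt 𝕜 Ring.inverse (A + σ₀ • K) := by simpa using analyticAt_inverse (𝕜 := 𝕜) hU.unit
  exact AnalyticAt.comp (f := fun σ : 𝕜 => A + σ • K) (x := σ₀) h2 h1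

/-- The EVANS FUNCTION `E(σ) = 1 − θ ℓ((A + σK)⁻¹ f)` is analytic at every `σ₀` where the pencil is a unit.
[cite: Kato1966, VII-§1.1, elementary case] -/
theorem analyticAt_evans (A K : E →L[𝕜] E) (ℓ : E →L[𝕜] 𝕜) (f : E) (θ : 𝕜) {σ₀ : 𝕜}
    (hU : IsUnit (A + σ₀ • K)) :
    AnalyticAt 𝕜 (fun σ : 𝕜 => 1 - θ * ℓ (Ring.inverse (A + σ • K) f)) σ₀ := by
  -- `T ↦ ℓ (T f)` is a bounded linear functional on `E →L[𝕜] E`, composed with the analytic resolvent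
  have h3 : AnalyticAt 𝕜 (fun T : E →L[𝕜] E => ℓ (T f)) (Ring.inverse (A + σ₀ • K)) :=
    (ℓ.comp (ContinuousLinearMap.apply 𝕜 E f)).analyticAt _
  exact analyticAt_const.sub (analyticAt_const.mul (AnalyticAt.comp
    (f := fun σ : 𝕜 => Ring.inverse (A + σ • K)) (x := σ₀) h3 (analyticAt_ring_inverse_pencil A K hU)))

/-- On the coercive half-plane `{σ : −b < Re σ}` the resolvent of the pencil is analytic.
[cite: Kato1966, VII-§1.1 and V-§3.11, elementary case] -/
theorem analyticOnNhd_ring_inverse_pencil (A K : E →L[𝕜] E) (ι : E →L[𝕜] W)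
    (hK : ∀ u, ⟪K u, u⟫_𝕜 = ((‖ι u‖ ^ 2 : ℝ) : 𝕜)) {a b : ℝ} (ha : 0 < a)
    (hA : ∀ u, a * (‖u‖ ^ 2 - ‖ι u‖ ^ 2) + b * ‖ι u‖ ^ 2 ≤ re ⟪A u, u⟫_𝕜)
    (hι : ∀ u, ‖ι u‖ ≤ ‖u‖) :
    AnalyticOnNhd 𝕜 (fun σ : 𝕜 => Ring.inverse (A + σ • K)) {σ : 𝕜 | -b < re σ} := fun σ hσ =>
  analyticAt_ring_inverse_pencil A K (isUnit_pencil A K ι hK ha hA hι (σ := σ) (by simp at hσ; linarith)).1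

/-- On the coercive half-plane the Evans function is analytic — the hypothesis under which the tree's argument
principle (`Literature.Analysis.Complex.ArgumentPrincipleRectangle`, `…Winding`) counts its zeros.
[cite: Kato1966, VII-§1.1 and V-§3.11, elementary case] -/
theorem analyticOnNhd_evans (A K : E →L[𝕜] E) (ι : E →L[𝕜] W)
    (hK : ∀ u, ⟪K u, u⟫_𝕜 = ((‖ι u‖ ^ 2 : ℝ) : 𝕜)) {a b : ℝ} (ha : 0 < a)
    (hA : ∀ u, a * (‖u‖ ^ 2 - ‖ι u‖ ^ 2) + b * ‖ι u‖ ^ 2 ≤ re ⟪A u, u⟫_𝕜)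
    (hι : ∀ u, ‖ι u‖ ≤ ‖u‖) (ℓ : E →L[𝕜] 𝕜) (f : E) (θ : 𝕜) :
    AnalyticOnNhd 𝕜 (fun σ : 𝕜 => 1 - θ * ℓ (Ring.inverse (A + σ • K) f)) {σ : 𝕜 | -b < re σ} :=
  fun σ hσ => analyticAt_evans A K ℓ f θ (isUnit_pencil A K ι hK ha hA hι (σ := σ) (by simp at hσ; linarith)).1

/-- **Eigenvalues inside the half-plane are the zeros of the Evans function.**  For `σ` with `0 < b + Re σ`,
the rank-one–modified pencil `A + σK − θ ℓ(·) f` (`= DG + σJ` when `A = DG + θ ℓ(·) f`) has a nontrivial kernel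
iff `1 − θ ℓ((A + σK)⁻¹ f) = 0`. [cite: Kato1966, III-§4.3, (4.13) and IV-§1.4 Thm. 1.16 (degenerate perturbations)] -/
theorem pencil_rankOne_kernel_iff (A K : E →L[𝕜] E) (ι : E →L[𝕜] W)
    (hK : ∀ u, ⟪K u, u⟫_𝕜 = ((‖ι u‖ ^ 2 : ℝ) : 𝕜)) {a b : ℝ} (ha : 0 < a)
    (hA : ∀ u, a * (‖u‖ ^ 2 - ‖ι u‖ ^ 2) + b * ‖ι u‖ ^ 2 ≤ re ⟪A u, u⟫_𝕜)
    (hι : ∀ u, ‖ι u‖ ≤ ‖u‖) (ℓ : E →L[𝕜] 𝕜) (f : E) (θ : 𝕜) {σ : 𝕜} (hσ : 0 < b + re σ) :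
    (∃ u, u ≠ 0 ∧ (A + σ • K - (θ • ℓ).smulRight f) u = 0) ↔
      1 - θ * ℓ (Ring.inverse (A + σ • K) f) = 0 := by
  obtain ⟨-, hPR, hRP, -⟩ := isUnit_pencil A K ι hK ha hA hι hσ
  rw [rankOne_kernel_iff (A + σ • K) (Ring.inverse (A + σ • K)) hPR hRP f (θ • ℓ),
    smul_apply, smul_eq_mul, sub_eq_zero, eq_comm]

end Analytic

end Literature.Analysis.OperatorTheory
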